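import Summits.HodgeConjecture.HodgeConjecture.Theorems.F0P3KitFamilyOfRecord   -- ★ p822799 (K9 interface, F0P3-p04 (g7)): `FrameData`, `kitFamilyOfRecord`, `isPinned_kitFamilyOfRecord` (+ ★ K1′ `isPinned_kitOfRecord₀`)
import Summits.HodgeConjecture.HodgeConjecture.Theorems.F0P3KitOfRecordWTransport  -- ★1b p847021 (F0P3a-p02 (g15), ED. 38): `isPinned_kitOfRecordW₀`, the `Iff.rfl` transports, the in-house rows at `𝔠₀^W` (+ ★1 p847005 `kitOfRecordW`)
import HarnessLib

/-!
# Crux `H413` — closer ED. 38 «PK-ε», ★6 «REL♯-W» (w1): **the kit FAMILY of record WITH THE ROOT-NUMBER SIGN, `kitFamilyOfRecordW 𝔇W`**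

F0∕P3 «U3-mult», cell `hodgecm-mathlib`, crux H413 (`stmt-HodgeConjecture-24833`); RULING D53-pre (desk heir F0P3-plan (g12)) PART A (4) ★6 as worded 22:28:34Z («FIELD, NOT
PARAMETER»); LEAD F0P3a-plan (g12) T11-70; pen F0P2-p02 (g12) (lineage author of ★ `F0P3RelParityOfRecord`).  THEOREMS-SIDE, ADDITIVE: ★ `FrameData` ∕ `kitFamilyOfRecord` ∕
`isPinned_kitFamilyOfRecord` (p822799) are untouched; this file is their twin over ★1 `kitOfRecordW`.

THE MATHEMATICS (Rogawski 1990 Thm. 14.6.4 as corrected by Rogawski 1992 Thm. 1.2: `m(π) = ½(1 + W(ξ)·(−1)^{n(π)+N})`, `W(ξ) = ε(½, φ_ξ) ∈ {±1}`).  The per-frame external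
data of the kit of record acquire ONE more letter, the root-number sign `wXi : OneDimAutRepH L → ℤ` (∃-bound in the tuple letter beside `c`, `jInf`, `dsInf`), so:
* §1 `structure FrameDataW … extends FrameData L H ι T hT μ` with the one new field `wXi`;
* §2 `def kitFamilyOfRecordW (𝔇W : ∀ frame, FrameDataW …) : KitFamily := fun frame => kitOfRecordW … μω (𝔇W frame).wXi (𝔇W frame).c …` (★ `kitFamilyOfRecord` :81–:98 twin over
  ★1, incl. the `letI`∕`haveI` Borel lines) + `kitFamilyOfRecordW_apply` (`rfl`) + `kitFamilyOfRecord_toFrameData_apply` (the sign-blind family of `𝔇W`, frame by frame, is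
  ★ `kitOfRecord` at the same data — for re-using sign-blind ★ facts stated at `kitFamilyOfRecord 𝔇`);
* §3 `isPinned_kitFamilyOfRecordW 𝔇W : (kitFamilyOfRecordW 𝔇W).IsPinned` — NO HYPOTHESIS: ★ V6 `IsPinned` reads `mult cl ramCls clFin μv evp hat Unr cptTriv` only (sign-blind), so
  ★1b `isPinned_kitOfRecordW₀` (= ★ K1′ `isPinned_kitOfRecord₀` moved across by `Iff.rfl`) closes it frame by frame.
One structure + one def WITH BODIES + theorems; no `sorry`, no named fact, no instance, no notation.  `--supports stmt-HodgeConjecture-24833`.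
HONEST LABEL: HC_CM is proved only modulo the printed citations until rung 0 closes; this file is count-neutral support (plumbing + transports, no new mathematics).

References: [Rogawski1990] §14.6 Thm. 14.6.4 pp. 236–244, §14.5 p. 237, §13.7 p. 206; [Rogawski1992] J. D. Rogawski, *The multiplicity formula for A-packets*, in: The zeta
functions of Picard modular surfaces (CRM, 1992) 395–419, Thm. 1.2 p. 397, §6 p. 417; [FlathCorvallis1979] Thm. 3.
-/

set_option autoImplicit false
set_option linter.dupNamespace false

noncomputable section

open NumberField IsDedekindDomain MeasureTheory
open Literature.NumberTheory.Rogawski1990 Literature.NumberTheory.GaloisRepresentations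
open Literature.NumberTheory.Automorphic Literature.NumberTheory.Automorphic.UnitaryGroup
open Literature.NumberTheory.Automorphic.UnitaryGroup.CotangentForms
open Literature.RepresentationTheory.BorelWallach2000 Literature.RepresentationTheory.KonnoKonno2007
open scoped Matrix ComplexOrder

namespace Summit.HodgeConjecture.HodgeConjecture.Cruxes.H413.F0P3KitOfRecordW

open Summit.HodgeConjecture.HodgeConjecture.Cruxes.H413.F0P3InnerFormClassificationV6
open Summit.HodgeConjecture.HodgeConjecture.Cruxes.H413.F0P3RamClsOfRecord (ramCls₀)
open Summit.HodgeConjecture.HodgeConjecture.Cruxes.H413.F0P3KitOfRecord (FrameData kitOfRecord kitFamilyOfRecord)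

/-! ## §1 Per-frame external data WITH the root-number sign -/

/-- **`FrameDataW L H ι T hT μ`** — ★ `FrameData` (T1's sockets, the G∕H-side carriers, the ξ∕packet data, the sign `c`, `jInf`, `dsInf`, `archTr`, the Haar data) EXTENDED
by ONE field: the global root numbers `W(φ_ξ) = ε(½, φ_ξ) ∈ {±1}` of the packet characters `φ_ξ := μω·(χ₁ξ)_L`, ∃-bound per frame by the tuple letter exactly like `c`,
`jInf`, `dsInf` (RULING D53-pre (9): field, not parameter). [cite: Rogawski1992, Thm. 1.2 p. 397] [cite: Rogawski1990, §14.6 Thm. 14.6.4 pp. 236–244] -/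
structure FrameDataW (L : Type) [Field L] [NumberField L] [IsCMField L] (H : Matrix (Fin 3) (Fin 3) L) (ι : L →+* ℂ) (T : GL (Fin 3) ℂ)
    (hT : (T : Matrix (Fin 3) (Fin 3) ℂ)ᴴ * H.map ι * (T : Matrix (Fin 3) (Fin 3) ℂ) = Literature.Geometry.ComplexHyperbolic.BallModel.J)
    (μ : Measure (Gp L H).automorphicQuotient) [(Gp L H).IsAutomorphicMeasure μ] : Type 2 extends FrameData L H ι T hT μ where
  /-- the global root numbers `W(φ_ξ) = ε(½, φ_ξ) ∈ {±1}` of the packet characters [Rogawski1992, Thm. 1.2 p. 397] -/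
  wXi : OneDimAutRepH L → ℤ

/-! ## §2 The kit family of record with the root-number sign -/

/-- **`kitFamilyOfRecordW 𝔇W : KitFamily`** — at every letters' frame the kit of record WITH THE ROOT-NUMBER SIGN ★1 `kitOfRecordW` (exact ramification set ★ `ramCls₀`, the family's own
`μω`, the external data `𝔇W frame` incl. `wXi`); the Borel structure on `G′(𝔸)` fixed inside — ★ `kitFamilyOfRecord` :81–:98 token for token with `kitOfRecord … μω c ↦
kitOfRecordW … μω (𝔇W …).wXi (𝔇W …).c`. [cite: Rogawski1990, §14.6 Thm. 14.6.4 pp. 236–244] [cite: Rogawski1992, Thm. 1.2 p. 397] -/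
def kitFamilyOfRecordW
    (𝔇W : ∀ (L : Type) [Field L] [NumberField L] [IsCMField L] (ι : L →+* ℂ) (H : Matrix (Fin 3) (Fin 3) L) (T : GL (Fin 3) ℂ)
      (hT : (T : Matrix (Fin 3) (Fin 3) ℂ)ᴴ * H.map ι * (T : Matrix (Fin 3) (Fin 3) ℂ) = Literature.Geometry.ComplexHyperbolic.BallModel.J),
      (∀ τ' : L →+* ℂ, InfinitePlace.mk τ' ≠ InfinitePlace.mk ι → (H.map τ').PosDef) →
      2 ≤ Module.finrank ℚ ↥(maximalRealSubfield L) →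
      ∀ (μ : Measure (Gp L H).automorphicQuotient) [(Gp L H).IsAutomorphicMeasure μ] (μω : HeckeCharacter L) (_hμu : μω.IsUnitary),
      (∀ x : Literature.NumberTheory.GaloisRepresentations.ideleGroup ↥(maximalRealSubfield L),
        μω (AdeleRing.ideleBaseChange (↥(maximalRealSubfield L)) L x) = quadraticHeckeCharCM L x) → FrameDataW L H ι T hT μ) :
    KitFamily :=
  fun L _ _ _ ι H T hT hdef h2 μ _ μω hμu hμω =>
    letI : MeasurableSpace (Gp L H).Adelic := borel _
    haveI : BorelSpace (Gp L H).Adelic := ⟨rfl⟩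
    haveI := (𝔇W L ι H T hT hdef h2 μ μω hμu hμω).isFiniteMeasureOnCompacts_ν
    kitOfRecordW L H ι T hT μ (𝔇W L ι H T hT hdef h2 μ μω hμu hμω).𝔰 (𝔇W L ι H T hT hdef h2 μ μω hμu hμω).gh (𝔇W L ι H T hT hdef h2 μ μω hμu hμω).ξd μω
      (𝔇W L ι H T hT hdef h2 μ μω hμu hμω).wXi (𝔇W L ι H T hT hdef h2 μ μω hμu hμω).c (𝔇W L ι H T hT hdef h2 μ μω hμu hμω).jInf (𝔇W L ι H T hT hdef h2 μ μω hμu hμω).dsInf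
      (𝔇W L ι H T hT hdef h2 μ μω hμu hμω).archTr (𝔇W L ι H T hT hdef h2 μ μω hμu hμω).ν (𝔇W L ι H T hT hdef h2 μ μω hμu hμω).μv ramCls₀

section Family

variable (𝔇W : ∀ (L : Type) [Field L] [NumberField L] [IsCMField L] (ι : L →+* ℂ) (H : Matrix (Fin 3) (Fin 3) L) (T : GL (Fin 3) ℂ)
      (hT : (T : Matrix (Fin 3) (Fin 3) ℂ)ᴴ * H.map ι * (T : Matrix (Fin 3) (Fin 3) ℂ) = Literature.Geometry.ComplexHyperbolic.BallModel.J),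
      (∀ τ' : L →+* ℂ, InfinitePlace.mk τ' ≠ InfinitePlace.mk ι → (H.map τ').PosDef) →
      2 ≤ Module.finrank ℚ ↥(maximalRealSubfield L) →
      ∀ (μ : Measure (Gp L H).automorphicQuotient) [(Gp L H).IsAutomorphicMeasure μ] (μω : HeckeCharacter L) (_hμu : μω.IsUnitary),
      (∀ x : Literature.NumberTheory.GaloisRepresentations.ideleGroup ↥(maximalRealSubfield L),
        μω (AdeleRing.ideleBaseChange (↥(maximalRealSubfield L)) L x) = quadraticHeckeCharCM L x) → FrameDataW L H ι T hT μ)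

/-- Unfolding `kitFamilyOfRecordW` at a frame (`rfl`). -/
theorem kitFamilyOfRecordW_apply (L : Type) [Field L] [NumberField L] [IsCMField L] (ι : L →+* ℂ) (H : Matrix (Fin 3) (Fin 3) L) (T : GL (Fin 3) ℂ)
    (hT : (T : Matrix (Fin 3) (Fin 3) ℂ)ᴴ * H.map ι * (T : Matrix (Fin 3) (Fin 3) ℂ) = Literature.Geometry.ComplexHyperbolic.BallModel.J)
    (hdef : ∀ τ' : L →+* ℂ, InfinitePlace.mk τ' ≠ InfinitePlace.mk ι → (H.map τ').PosDef) (h2 : 2 ≤ Module.finrank ℚ ↥(maximalRealSubfield L))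
    (μ : Measure (Gp L H).automorphicQuotient) [(Gp L H).IsAutomorphicMeasure μ] (μω : HeckeCharacter L) (hμu : μω.IsUnitary)
    (hμω : ∀ x : Literature.NumberTheory.GaloisRepresentations.ideleGroup ↥(maximalRealSubfield L),
      μω (AdeleRing.ideleBaseChange (↥(maximalRealSubfield L)) L x) = quadraticHeckeCharCM L x) :
    kitFamilyOfRecordW 𝔇W L ι H T hT hdef h2 μ μω hμu hμω =
      (letI : MeasurableSpace (Gp L H).Adelic := borel _
       haveI : BorelSpace (Gp L H).Adelic := ⟨rfl⟩
       haveI := (𝔇W L ι H T hT hdef h2 μ μω hμu hμω).isFiniteMeasureOnCompacts_ν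
       kitOfRecordW L H ι T hT μ (𝔇W L ι H T hT hdef h2 μ μω hμu hμω).𝔰 (𝔇W L ι H T hT hdef h2 μ μω hμu hμω).gh (𝔇W L ι H T hT hdef h2 μ μω hμu hμω).ξd μω
         (𝔇W L ι H T hT hdef h2 μ μω hμu hμω).wXi (𝔇W L ι H T hT hdef h2 μ μω hμu hμω).c (𝔇W L ι H T hT hdef h2 μ μω hμu hμω).jInf (𝔇W L ι H T hT hdef h2 μ μω hμu hμω).dsInf
         (𝔇W L ι H T hT hdef h2 μ μω hμu hμω).archTr (𝔇W L ι H T hT hdef h2 μ μω hμu hμω).ν (𝔇W L ι H T hT hdef h2 μ μω hμu hμω).μv ramCls₀) := rfl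

/-- **The sign-blind family of `𝔇W`**: `kitFamilyOfRecord` of the `FrameData` part of `𝔇W` is, frame by frame, ★ `kitOfRecord` at the same external data WITHOUT `wXi` (`rfl`) — so
every sign-blind ★ fact stated at `kitFamilyOfRecord 𝔇` is available at `𝔇 := fun … => (𝔇W …).toFrameData` and transports to `kitFamilyOfRecordW 𝔇W` through ★1's `rfl`
read-backs. [cite: Rogawski1990, §14.6 Thm. 14.6.4 p. 244] -/
theorem kitFamilyOfRecord_toFrameData_apply (L : Type) [Field L] [NumberField L] [IsCMField L] (ι : L →+* ℂ) (H : Matrix (Fin 3) (Fin 3) L) (T : GL (Fin 3) ℂ)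
    (hT : (T : Matrix (Fin 3) (Fin 3) ℂ)ᴴ * H.map ι * (T : Matrix (Fin 3) (Fin 3) ℂ) = Literature.Geometry.ComplexHyperbolic.BallModel.J)
    (hdef : ∀ τ' : L →+* ℂ, InfinitePlace.mk τ' ≠ InfinitePlace.mk ι → (H.map τ').PosDef) (h2 : 2 ≤ Module.finrank ℚ ↥(maximalRealSubfield L))
    (μ : Measure (Gp L H).automorphicQuotient) [(Gp L H).IsAutomorphicMeasure μ] (μω : HeckeCharacter L) (hμu : μω.IsUnitary)
    (hμω : ∀ x : Literature.NumberTheory.GaloisRepresentations.ideleGroup ↥(maximalRealSubfield L),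
      μω (AdeleRing.ideleBaseChange (↥(maximalRealSubfield L)) L x) = quadraticHeckeCharCM L x) :
    kitFamilyOfRecord (fun L _ _ _ ι H T hT hdef h2 μ _ μω hμu hμω => (𝔇W L ι H T hT hdef h2 μ μω hμu hμω).toFrameData) L ι H T hT hdef h2 μ μω hμu hμω =
      (letI : MeasurableSpace (Gp L H).Adelic := borel _
       haveI : BorelSpace (Gp L H).Adelic := ⟨rfl⟩
       haveI := (𝔇W L ι H T hT hdef h2 μ μω hμu hμω).isFiniteMeasureOnCompacts_ν
       kitOfRecord L H ι T hT μ (𝔇W L ι H T hT hdef h2 μ μω hμu hμω).𝔰 (𝔇W L ι H T hT hdef h2 μ μω hμu hμω).gh (𝔇W L ι H T hT hdef h2 μ μω hμu hμω).ξd μω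
         (𝔇W L ι H T hT hdef h2 μ μω hμu hμω).c (𝔇W L ι H T hT hdef h2 μ μω hμu hμω).jInf (𝔇W L ι H T hT hdef h2 μ μω hμu hμω).dsInf
         (𝔇W L ι H T hT hdef h2 μ μω hμu hμω).archTr (𝔇W L ι H T hT hdef h2 μ μω hμu hμω).ν (𝔇W L ι H T hT hdef h2 μ μω hμu hμω).μv ramCls₀) := rfl

/-! ## §3 The family is PINNED — no hypothesis (`IsPinned` is sign-blind) -/

/-- **`isPinned_kitFamilyOfRecordW 𝔇W : (kitFamilyOfRecordW 𝔇W).IsPinned`** — NO HYPOTHESIS: at every letters' frame the W-kit of record is pinned.  ★ V6 `IsPinned` (i)–(x) reads the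
fields `mult cl ramCls clFin μv evp hat Unr cptTriv` only, all of which ★1's structure update leaves DEFINITIONALLY `kitOfRecord`'s; the proof term is ★1b `isPinned_kitOfRecordW₀`
(= ★ K1′ `isPinned_kitOfRecord₀` across `isPinned_kitOfRecordW_iff`; compact CM frame `hdef h2`, Haar facts from `𝔇W`) — ★ `isPinned_kitFamilyOfRecord` :127 twin. [cite: Rogawski1990, §14.5 p. 237; §13.7 p. 206] [cite: FlathCorvallis1979, Thm. 3] -/
theorem isPinned_kitFamilyOfRecordW : (kitFamilyOfRecordW 𝔇W).IsPinned := by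
  intro L _ _ _ ι H T hT hdef h2 μ _ μω hμu hμω
  letI : MeasurableSpace (Gp L H).Adelic := borel _
  haveI : BorelSpace (Gp L H).Adelic := ⟨rfl⟩
  haveI := (𝔇W L ι H T hT hdef h2 μ μω hμu hμω).isFiniteMeasureOnCompacts_ν
  exact isPinned_kitOfRecordW₀ L H ι T hT μ (𝔇W L ι H T hT hdef h2 μ μω hμu hμω).𝔰 (𝔇W L ι H T hT hdef h2 μ μω hμu hμω).gh (𝔇W L ι H T hT hdef h2 μ μω hμu hμω).ξd μω
    (𝔇W L ι H T hT hdef h2 μ μω hμu hμω).wXi (𝔇W L ι H T hT hdef h2 μ μω hμu hμω).c (𝔇W L ι H T hT hdef h2 μ μω hμu hμω).jInf (𝔇W L ι H T hT hdef h2 μ μω hμu hμω).dsInf (𝔇W L ι H T hT hdef h2 μ μω hμu hμω).archTr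
    (𝔇W L ι H T hT hdef h2 μ μω hμu hμω).ν (𝔇W L ι H T hT hdef h2 μ μω hμu hμω).μv hdef h2 (𝔇W L ι H T hT hdef h2 μ μω hμu hμω).isHaarMeasure_μv

end Family

end Summit.HodgeConjecture.HodgeConjecture.Cruxes.H413.F0P3KitOfRecordW

end
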